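import Literature.Geometry.Riemannian.MetricFlowCorrespondence
import Mathlib.MeasureTheory.OuterMeasure.BorelCantelli
import Mathlib.Analysis.SpecificLimits.Basic
import HarnessLib

/-!
# `𝔽`-convergence within a correspondence is time-wise at almost every time, after passing to
# a subsequence (Bamler 2023, §6.1, Lemma 6.3, first assertion)

R. Bamler, *Compactness theory of the space of super Ricci flows*, Invent. Math. 233 (2023),
§6.1, Lemma 6.3 (arXiv v1 Lemma 126): *"If (6.2) holds [`𝔽`-convergence within `ℭ`, uniform over
`J`], then (6.2) also holds in the time-wise sense [uniform over `J ∪ {t}`] at almost every time,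
after passing to a subsequence."* Proof (source): the admissible radii `rᵢ → 0` of
`d_𝔽^{ℭ,J}((𝒳ⁱ, μⁱ), (𝒳^∞, μ^∞)) < rᵢ` come with measurable exceptional sets `Eᵢ ⊆ I''`,
`|Eᵢ| ≤ rᵢ²`; after passing to a subsequence `Σ rᵢ² < ∞`, so `E_∞ := limsup Eᵢ` is a null set
(Borel–Cantelli), and for `t ∉ E_∞` the same witnesses (`Eᵢ`, the couplings `q_t`) are admissible
for `J ∪ {t}` as soon as `t ∉ Eᵢ`.

This file proves the assertion over the tree's `MetricFlow.FamilyCorrespondence` /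
`MetricFlowPair.FConvergesWithin` (`MetricFlowCorrespondence.lean`):

* `MetricFlow.FamilyCorrespondence.alongSubseq ℭ φ` — the correspondence between the flows of a
  subsequence `P ∘ φ` and the limit, with
  `(ℭ.alongSubseq φ).pair (some n) none = ℭ.pair (some (φ n)) none` definitionally;
* `MetricFlowPair.FDistAdmissibleWith P₁ P₂ ℭ E J r` — admissibility of `r` for `d_𝔽^{ℭ,J}` WITH a
  given exceptional set `E` (the body of `FDistAdmissible`), `fDistAdmissible_iff_exists`, and
  `FDistAdmissibleWith.insert_time` (the same witnesses are admissible for `J ∪ {t}` if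
  `t ∈ I'' ∖ E`);
* `exists_subseq_fConvergesWithin_timewise` — **Lemma 6.3, first assertion**.

No named facts; the only definitions are `alongSubseq` and `FDistAdmissibleWith`.

## References

* R. H. Bamler, *Compactness theory of the space of super Ricci flows*, Invent. Math. 233 (2023),
  1121–1277 (arXiv:2008.09298), §6.1, Def. 6.1, Lemma 6.3; §5.1, Def. 5.6. [Bamler2023]
-/

noncomputable section

open Set MeasureTheory Filter TopologicalSpace Function
open scoped Topology ENNReal NNReal

namespace Literature.Geometry.Riemannian

universe u

/-! ### Reindexing a correspondence along a subsequence -/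

namespace MetricFlow

namespace FamilyCorrespondence

variable {I₀ I'' : Set ℝ} {P : ℕ → MetricFlowPair.{u} I₀} {Pinf : MetricFlowPair.{u} I₀}

/-- **The correspondence along a subsequence** (Bamler 2023, §6.1, "after passing to a
subsequence"): from a correspondence `ℭ` between the flows of `P n`, `n ∈ ℕ`, and `Pinf` (indexed
by `Option ℕ`, `none = ∞`) and `φ : ℕ → ℕ`, the correspondence between the flows of `P (φ n)` and
`Pinf` with the same comparison spaces, domains `dom (some n) := ℭ.dom (some (φ n))` and embeddings.
[cite: Bamler2023, §6.1, Lemma 6.3] -/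
def alongSubseq (ℭ : FamilyCorrespondence (fun o : Option ℕ ↦ (o.elim Pinf P).flow) I'')
    (φ : ℕ → ℕ) : FamilyCorrespondence (fun o : Option ℕ ↦ (o.elim Pinf (P ∘ φ)).flow) I'' where
  Z := ℭ.Z
  dom := fun o ↦ ℭ.dom (o.map φ)
  dom_subset := fun o ↦ match o with
    | none => ℭ.dom_subset none
    | some n => ℭ.dom_subset (some (φ n))
  φ := fun o ↦ match o with
    | none => ℭ.φ none
    | some n => ℭ.φ (some (φ n))
  isometry := fun o ↦ match o with
    | none => ℭ.isometry none
    | some n => ℭ.isometry (some (φ n))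

/-- The pair correspondences along a subsequence are those of `ℭ` at the reindexed places
(definitionally). [cite: Bamler2023, §6.1, Lemma 6.3] -/
@[simp] theorem alongSubseq_pair
    (ℭ : FamilyCorrespondence (fun o : Option ℕ ↦ (o.elim Pinf P).flow) I'') (φ : ℕ → ℕ) (n : ℕ) :
    (ℭ.alongSubseq φ).pair (some n) none = ℭ.pair (some (φ n)) none := rfl

/-- A correspondence fully defined over `J` stays fully defined over `J` along a subsequence.
[cite: Bamler2023, §6.1, Lemma 6.3] -/
theorem FullyDefinedOver.alongSubseq
    {ℭ : FamilyCorrespondence (fun o : Option ℕ ↦ (o.elim Pinf P).flow) I''} {J : Set ℝ}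
    (h : ℭ.FullyDefinedOver J) (φ : ℕ → ℕ) : (ℭ.alongSubseq φ).FullyDefinedOver J :=
  fun o ↦ h (o.map φ)

end FamilyCorrespondence

end MetricFlow

/-! ### Admissibility with a given exceptional set -/

namespace MetricFlowPair

open MetricFlow

variable {I₁ I₂ : Set ℝ}

/-- **Admissible radii for `d_𝔽^{ℭ,J}` with a given exceptional set `E`** (the property of Bamler
2023, §5.1, Def. 5.6 with `E` fixed): `r > 0`, `E ⊆ I''` measurable with `J ⊆ I'' ∖ E ⊆
I''^{,1} ∩ I''^{,2}`, `|E| ≤ r²`, and couplings `q_t`, `t ∈ I'' ∖ E`, of `μ¹_t, μ²_t` with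
`∫ d_{W₁}^{Z_s}((φ¹_s)_* ν¹_{x¹;s}, (φ²_s)_* ν²_{x²;s}) dq_t ≤ r` for `s ≤ t` in `I'' ∖ E`.
[cite: Bamler2023, §5.1, Def. 5.6 (F-distance within correspondence)] -/
def FDistAdmissibleWith (P₁ : MetricFlowPair.{u} I₁) (P₂ : MetricFlowPair.{u} I₂) {I'' : Set ℝ}
    (ℭ : Correspondence₂ P₁.flow P₂.flow I'') (E J : Set ℝ) (r : ℝ) : Prop :=
  0 < r ∧ ∃ (_ : MeasurableSet E) (_ : E ⊆ I'') (_ : J ⊆ I'' \ E)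
    (hE₁ : I'' \ E ⊆ ℭ.dom₁) (hE₂ : I'' \ E ⊆ ℭ.dom₂) (_ : volume E ≤ ENNReal.ofReal (r ^ 2))
    (q : ∀ t (ht : t ∈ I'' \ E),
      Measure (P₁.flow.Slice ⟨t, (ℭ.dom₁_subset (hE₁ ht)).1⟩ ×
        P₂.flow.Slice ⟨t, (ℭ.dom₂_subset (hE₂ ht)).1⟩)),
    (∀ t (ht : t ∈ I'' \ E),
      IsCoupling (P₁.μ ⟨t, (ℭ.dom₁_subset (hE₁ ht)).1⟩) (P₂.μ ⟨t, (ℭ.dom₂_subset (hE₂ ht)).1⟩)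
        (q t ht)) ∧
    ∀ s (hs : s ∈ I'' \ E) t (ht : t ∈ I'' \ E), s ≤ t →
      ∫⁻ p, kernelDistWithin P₁ P₂ ℭ (hE₁ hs) (hE₂ hs) (hE₁ ht) (hE₂ ht) p ∂(q t ht) ≤
        ENNReal.ofReal r

variable {P₁ : MetricFlowPair.{u} I₁} {P₂ : MetricFlowPair.{u} I₂} {I'' : Set ℝ}
  {ℭ : Correspondence₂ P₁.flow P₂.flow I''} {J E : Set ℝ} {r : ℝ}

/-- `r` is admissible iff it is admissible with some exceptional set `E`.
[cite: Bamler2023, §5.1, Def. 5.6 (F-distance within correspondence)] -/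
theorem fDistAdmissible_iff_exists :
    FDistAdmissible P₁ P₂ ℭ J r ↔ ∃ E, FDistAdmissibleWith P₁ P₂ ℭ E J r :=
  ⟨fun ⟨hr, E, h⟩ ↦ ⟨E, hr, h⟩, fun ⟨E, hr, h⟩ ↦ ⟨hr, E, h⟩⟩

/-- Admissibility with `E` implies admissibility.
[cite: Bamler2023, §5.1, Def. 5.6 (F-distance within correspondence)] -/
theorem FDistAdmissibleWith.fDistAdmissible (h : FDistAdmissibleWith P₁ P₂ ℭ E J r) :
    FDistAdmissible P₁ P₂ ℭ J r :=
  fDistAdmissible_iff_exists.2 ⟨E, h⟩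

/-- The exceptional set of an admissible radius is measurable.
[cite: Bamler2023, §5.1, Def. 5.6 (F-distance within correspondence)] -/
theorem FDistAdmissibleWith.measurableSet (h : FDistAdmissibleWith P₁ P₂ ℭ E J r) :
    MeasurableSet E :=
  h.2.1

/-- The exceptional set of an admissible radius lies in `I''`.
[cite: Bamler2023, §5.1, Def. 5.6 (F-distance within correspondence)] -/
theorem FDistAdmissibleWith.subset (h : FDistAdmissibleWith P₁ P₂ ℭ E J r) : E ⊆ I'' :=
  h.2.2.1

/-- The exceptional set of an admissible radius `r` has measure `≤ r²`.
[cite: Bamler2023, §5.1, Def. 5.6 (F-distance within correspondence)] -/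
theorem FDistAdmissibleWith.volume_le (h : FDistAdmissibleWith P₁ P₂ ℭ E J r) :
    volume E ≤ ENNReal.ofReal (r ^ 2) :=
  h.2.2.2.2.2.2.1

/-- **The same witnesses are admissible for `J ∪ {t}` whenever `t ∈ I'' ∖ E`** (Bamler 2023,
§6.1, proof of Lemma 6.3: admissibility for `J` only requires `J ⊆ I'' ∖ E`).
[cite: Bamler2023, §6.1, Lemma 6.3] -/
theorem FDistAdmissibleWith.insert_time (h : FDistAdmissibleWith P₁ P₂ ℭ E J r) {t : ℝ}
    (ht : t ∈ I'') (htE : t ∉ E) : FDistAdmissibleWith P₁ P₂ ℭ E (insert t J) r := by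
  obtain ⟨hr, hEm, hEI, hJ, hE₁, hE₂, hvol, q, hq, hint⟩ := h
  exact ⟨hr, hEm, hEI, insert_subset_iff.2 ⟨⟨ht, htE⟩, hJ⟩, hE₁, hE₂, hvol, q, hq, hint⟩

/-- A `𝔽`-distance within a correspondence below `ofReal c` is witnessed by an admissible radius
`r < c` (the infimum defining `d_𝔽^{ℭ,J}`), hence `c` itself is admissible, with some exceptional
set. [cite: Bamler2023, §5.1, Def. 5.6 (F-distance within correspondence)] -/
theorem exists_fDistAdmissibleWith_of_fDistWithin_lt {c : ℝ} (hc : 0 < c)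
    (h : fDistWithin P₁ P₂ ℭ J < ENNReal.ofReal c) : ∃ E, FDistAdmissibleWith P₁ P₂ ℭ E J c := by
  simp only [fDistWithin, iInf_lt_iff] at h
  obtain ⟨r, hr, hrc⟩ := h
  have hrc' : r ≤ c := ((ENNReal.ofReal_lt_ofReal_iff hc).1 hrc).le
  exact fDistAdmissible_iff_exists.1 (hr.mono hrc')

end MetricFlowPair

/-! ### Lemma 6.3, first assertion -/

/-- **Bamler 2023, Lemma 6.3 (arXiv v1 Lemma 126), first assertion: after passing to a
subsequence, `𝔽`-convergence within a correspondence is time-wise at almost every time.** If the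
metric flow pairs `P n` `𝔽`-converge to `Pinf` within the correspondence `ℭ` uniformly over `J`,
then there are a subsequence `φ` and a measurable null set `E∞ ⊆ I''` such that for every
`t ∈ I'' ∖ E∞` the pairs `P (φ n)` `𝔽`-converge to `Pinf` within `ℭ` (along the subsequence,
`ℭ.alongSubseq φ`) uniformly over `J ∪ {t}`. Proof (source): admissible radii `2^{-(k+1)}` along a
subsequence, their exceptional sets `E_k` with `|E_k| ≤ 4^{-(k+1)}`, `E∞ := limsup E_k` is null by
Borel–Cantelli (`measure_limsup_atTop_eq_zero`), and for `t ∉ E∞` eventually `t ∉ E_k`, where the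
same witnesses are admissible for `J ∪ {t}` (`FDistAdmissibleWith.insert_time`).
[cite: Bamler2023, §6.1, Lemma 6.3] -/
theorem exists_subseq_fConvergesWithin_timewise {I₀ I'' : Set ℝ} {P : ℕ → MetricFlowPair.{u} I₀}
    {Pinf : MetricFlowPair.{u} I₀}
    {ℭ : MetricFlow.FamilyCorrespondence (fun o : Option ℕ ↦ (o.elim Pinf P).flow) I''} {J : Set ℝ}
    (h : MetricFlowPair.FConvergesWithin P Pinf ℭ J) :
    ∃ φ : ℕ → ℕ, StrictMono φ ∧ ∃ Einf : Set ℝ, MeasurableSet Einf ∧ volume Einf = 0 ∧ Einf ⊆ I'' ∧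
      ∀ t ∈ I'' \ Einf,
        MetricFlowPair.FConvergesWithin (P ∘ φ) Pinf (ℭ.alongSubseq φ) (insert t J) := by
  classical
  -- radii `ε k = (1/2)^(k+1)`
  set ε : ℕ → ℝ := fun k ↦ (1 / 2) ^ (k + 1) with hε
  have hε0 : ∀ k, 0 < ε k := fun k ↦ by positivity
  have hεt : Tendsto ε atTop (𝓝 0) := by
    have h1 : Tendsto (fun k : ℕ ↦ (1 / 2 : ℝ) ^ k) atTop (𝓝 0) :=
      tendsto_pow_atTop_nhds_zero_of_lt_one (by norm_num) (by norm_num)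
    exact h1.comp (tendsto_add_atTop_nat 1)
  -- eventually `d_𝔽^{ℭ,J}(P n, Pinf) < ε k`; extract a subsequence
  have hev : ∀ k, ∀ᶠ n in atTop,
      MetricFlowPair.fDistWithin (P n) Pinf (ℭ.pair (some n) none) J < ENNReal.ofReal (ε k) :=
    fun k ↦ h (Iio_mem_nhds (ENNReal.ofReal_pos.2 (hε0 k)))
  obtain ⟨φ, hφ, hφε⟩ := extraction_forall_of_eventually hev
  -- the exceptional sets along the subsequence
  have hadm : ∀ k, ∃ E, MetricFlowPair.FDistAdmissibleWith (P (φ k)) Pinf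
      (ℭ.pair (some (φ k)) none) E J (ε k) := fun k ↦
    MetricFlowPair.exists_fDistAdmissibleWith_of_fDistWithin_lt (hε0 k) (hφε k)
  choose E hE using hadm
  -- Borel–Cantelli
  have hsum : ∑' k, volume (E k) ≠ ∞ := by
    have hgeom : ∀ k, volume (E k) ≤ ENNReal.ofReal (1 / 4) ^ (k + 1) := by
      intro k
      refine (hE k).volume_le.trans (le_of_eq ?_)
      rw [← ENNReal.ofReal_pow (by norm_num)]
      congr 1
      show ((1 / 2 : ℝ) ^ (k + 1)) ^ 2 = (1 / 4) ^ (k + 1)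
      rw [← pow_mul, mul_comm, pow_mul]
      norm_num
    have h14 : ENNReal.ofReal (1 / 4) < 1 := by
      rw [← ENNReal.ofReal_one]; exact (ENNReal.ofReal_lt_ofReal_iff one_pos).2 (by norm_num)
    refine ne_top_of_le_ne_top ?_ (ENNReal.tsum_le_tsum hgeom)
    have e : ∑' k, ENNReal.ofReal (1 / 4) ^ (k + 1) =
        ENNReal.ofReal (1 / 4) * ∑' k, ENNReal.ofReal (1 / 4) ^ k := by
      rw [← ENNReal.tsum_mul_left]
      exact tsum_congr fun k ↦ by ring
    rw [e, ENNReal.tsum_geometric]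
    exact ENNReal.mul_ne_top ENNReal.ofReal_ne_top
      (ENNReal.inv_ne_top.2 (tsub_pos_iff_lt.2 h14).ne')
  refine ⟨φ, hφ, limsup E atTop, MeasurableSet.measurableSet_limsup fun k ↦ (hE k).measurableSet,
    measure_limsup_atTop_eq_zero hsum, ?_, ?_⟩
  · -- `limsup E ⊆ I''`
    intro t ht
    rw [mem_limsup_iff_frequently_mem] at ht
    obtain ⟨k, hk⟩ := ht.exists
    exact (hE k).subset hk
  · -- time-wise convergence off `limsup E`
    rintro t ⟨htI, htE⟩
    rw [mem_limsup_iff_frequently_mem, not_frequently] at htE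
    have hbound : ∀ᶠ k in atTop, MetricFlowPair.fDistWithin (P (φ k)) Pinf
        (ℭ.pair (some (φ k)) none) (insert t J) ≤ ENNReal.ofReal (ε k) := by
      filter_upwards [htE] with k hk
      exact MetricFlowPair.fDistWithin_le ((hE k).insert_time htI hk).fDistAdmissible
    have hεt' : Tendsto (fun k ↦ ENNReal.ofReal (ε k)) atTop (𝓝 0) := by
      rw [← ENNReal.ofReal_zero]
      exact ENNReal.tendsto_ofReal hεt
    exact tendsto_of_tendsto_of_tendsto_of_le_of_le' tendsto_const_nhds hεt'
      (Eventually.of_forall fun _ ↦ zero_le) hbound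

end Literature.Geometry.Riemannian

end
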